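import Literature.Probability.RandomPlanarGeometry.SelfAvoidingWalk
import Mathlib.Analysis.SpecialFunctions.Pow.Real
import Mathlib.Analysis.SpecialFunctions.Sqrt
import HarnessLib

/-!
# Bridges, squared walks, and self-avoiding polygons through the cardinal edges of a square
# (Duminil-Copin–Kozma–Yadin 2014, §2–§3): the combinatorial inputs of "supercritical
# self-avoiding walks are space-filling"

Topic `Literature/Probability/RandomPlanarGeometry` (next to `SelfAvoidingWalk.lean` and
`BDGS2012.lean`, whose `Literature.SAW.count = cₙ`, `Literature.SAW.connectiveConstant = μ = infₙ cₙ^{1/n}` and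
`Literature.SAW.criticalFugacity = 1/μ` are used). This file vendors, over the tree's square lattice
`zdGraph 2` and Mathlib's `SimpleGraph.Walk`, the objects and the numbered results of §2 of
H. Duminil-Copin, G. Kozma, A. Yadin, *Supercritical self-avoiding walks are space-filling*,
Ann. IHP Probab. Stat. 50 (2014) 315–326 (arXiv:1110.3074), which are the upstream nodes of the
printed proof of its Theorem 1 (`Literature.Barriers.CriticalPhenomena.SupercriticalSAW.DKY2014_thm1`,
file `Literature/Barriers/CriticalPhenomena/SupercriticalSAWSpaceFilling.lean`; the proof DAG is
recorded in `…/SupercriticalSAWSpaceFillingSteps.lean`), together with the box bookkeeping of §3.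

## What the source prints (§2 "Self-avoiding polygons in a square", §3)

* "For `m > 0`, let `P_m` be the set of self-avoiding polygons in `[0,2m+1]²` that touch the
  middle of every face of the square: more formally, such that the edges `[(m,0),(m+1,0)]`,
  `[(2m+1,m),(2m+1,m+1)]`, `[(m,2m+1),(m+1,2m+1)]` and `[(0,m),(0,m+1)]` belong to the polygon
  … For `x > 0`, let `Z_m(x)` be the partition function (with parameter `x`) of `P_m`, i.e.
  `Z_m(x) = Σ_{γ ∈ P_m} x^{|γ|}`." **Proposition 3.** "For `x > 1/μ`, we have
  `limsup_{m→∞} Z_m(x) = ∞`."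
* "The number `bₙ` of self-avoiding bridges of length `n`, meaning self-avoiding walks `γ` of
  length `n` such that `y(γ₀) = min_{t∈[0,n]} y(γ_t)` and `y(γₙ) = max_{t∈[0,n]} y(γ_t)`,
  satisfies `e^{-c√n} μⁿ ≤ bₙ ≤ μⁿ` **(2.1)** for every `n` [HammersleyWelsh] (see also
  [MadrasSlade] for a modern exposition)"; Theorem 4 (Hardy–Ramanujan 1917):
  `log P_D(A) ∼ π√(A/3)`.
* "A squared walk (of span `k`) is a self-avoiding walk such that `γ₀ = (0,0)`, `γₙ = (k,k)`
  and `γ ⊂ [0,k]²`." **Lemma 5.** "For `c` sufficiently large and `n` even, the number `aₙ` of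
  squared walks of length `n` satisfies `aₙ ≥ μⁿ e^{-c√n}`." (Proof: Step 1 unfolds a bridge
  into a walk contained in the rectangle spanned by its endpoints, an `e^{c√n}`-to-one map by
  Theorem 4; Step 2 glues two rectangle walks ending at `(k,l)` into a squared walk of span
  `k+l`.) Proof of Proposition 3: four squared walks of length `n` and the maximising span `m`
  assemble, with the four cardinal edges, into a polygon of `P_m`, so
  `Z_m(x) ≥ (x^{n+1} μⁿ e^{-c√n}/n)⁴ → ∞`.
* §3: "A cardinal edge of a (square) box `B` of side length `2m+1` is an edge of the lattice in
  the middle of one of the sides of `B`. … two boxes `B` and `B'` of side length `2m+1` are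
  said to be adjacent if they are disjoint and each has a cardinal edge, `[xy]` and `[zt]`
  respectively, such that `x ∼ z`, `y ∼ t` … A family `F` of boxes is called connected if every
  two boxes can be connected by a path of adjacent boxes in `F`. … we will assume that all our
  boxes have their lower left corner in `(2m+2)δℤ²`"; "`V_F` the set of vertices in boxes of `F`".
* Madras–Slade 1993: Definition 1.2.4 ("An `N`-step bridge is … a self-avoiding walk `ω` whose
  first components satisfy `ω₁(0) < ω₁(i) ≤ ω₁(N)` for `1 ≤ i ≤ N` … By convention, `b₀ = 1`"),
  eq. (1.2.17) (`b_N ≤ μ_Bridge^N ≤ μ^N`), Corollary 3.1.6 (`μ^N e^{-B√N} ≤ b_N ≤ μ^N` for `N`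
  large, any `B > π(2/3)^{1/2}`), Definition 3.2.1 (an `N`-step self-avoiding polygon is a set of
  `N` bonds: those of an `(N-1)`-step SAW with adjacent endpoints plus the closing bond).

## What is formalised (namespace `Literature.SAW`)

Definitions (with bodies): `IsBridge`, `bridgeCount n = bₙ` (vertical bridges from `0`,
Madras–Slade convention), `diag k = (k,k)`, `IsSquaredWalk`, `squaredWalkCount n = aₙ`,
`IsPolygon G E` (edge set of a cycle), `squareBox m = [0,2m+1]²`, `cardinalEdges m`,
`facePolygons m = P_m`, `Zbox m x = Z_m(x)`, `mBox m z = B(z) = (2m+2)z + [0,2m+1]²`,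
`boxVertices m F = V_F`, `IsConnectedFamily F`. Named facts (`def … : Prop`, not discharged
here): `DKY2014_eq21` (Hammersley–Welsh bridges), `DKY2014_lem5` (Lemma 5), `DKY2014_prop3`
(Proposition 3). PROVED API: `bridgeCount_le_count`, `squaredWalkCount_le_count`,
`bridgeCount_zero`, `squaredWalkCount_zero`, `IsPolygon.exists_length_eq`,
`mem_facePolygons_iff`, `Zbox_nonneg`, `Zbox_mono`, `mem_squareBox_iff`, `mem_mBox_iff`,
`mBox_zero`, `mem_boxVertices_iff`, and the non-vacuity of `P_0` (`UnitSquare.*`,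
`pow_four_le_Zbox_zero : x⁴ ≤ Z_0(x)`).

## Design choices

* Bridges are taken in the Hammersley–Welsh/Madras–Slade form (strict inequality at the start,
  here on the second coordinate as in the source's wording); the source's own wording
  ("`y(γ₀) = min`") is the weak form — (2.1) is the theorem printed for the former, and the
  proof of Lemma 5 only uses the lower bound, which holds for both.
* Walks are counted like `Literature.Probability.RandomPlanarGeometry.SAW.count`: `finsetWalkLength n 0 v` filtered, summed over the
  endpoints `v` in `box 2 n` (which contains every endpoint of an `n`-step walk from `0`); a
  squared walk carries its span through its endpoint `diag k`.
* Polygons are finite edge sets (Madras–Slade), so that `Z_m(x) = Σ_E x^{#E}` is a finite sum over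
  `facePolygons m ⊆ 𝒫(edgesIn (zdGraph 2) (squareBox m))`; `IsPolygon.exists_length_eq` recovers
  the length of a tracing cycle.
* Box adjacency is adjacency of corners in `ℤ²` (for grid-aligned boxes of side `2m+1` at
  spacing `2m+2` this is the printed cardinal-edge adjacency); `IsConnectedFamily F` is
  preconnectedness of the induced graph on the finite set of corners.
* `limsup Z_m(x) = ∞` is phrased `∀ M, ∃ᶠ m in atTop, M ≤ Z_m(x)`.
-/

noncomputable section

open Filter Topology Literature.Probability.LatticeModels Literature.Probability.Percolation
open scoped BigOperators

namespace Literature.Probability.RandomPlanarGeometry.SAW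

/-! ### Bridges and the Hammersley–Welsh bound -/

/-- A walk of `ℤ²` from the origin to `v` is a **bridge** (in the vertical direction) if it is
self-avoiding and `y(ω₀) < y(ωᵢ) ≤ y(ω_N)` for `1 ≤ i ≤ N` (Madras–Slade, Def. 1.2.4, with the
second coordinate; the source's wording "`y(γ₀) = min_t y(γ_t)` and `y(γ_n) = max_t y(γ_t)`"
is the weak form of the same notion — we take the Hammersley–Welsh/Madras–Slade convention,
strict at the start, for which (2.1) is the printed theorem). Since a bridge is a path from
`0`, the condition "`i ≥ 1`" is "`ωᵢ ≠ 0`". [cite: MadrasSlade1993, Definition 1.2.4]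
[cite: DuminilCopinKozmaYadin2014, §2 (before eq. (2.1))] -/
def IsBridge {v : Site 2} (p : (zdGraph 2).Walk (0 : Site 2) v) : Prop :=
  p.IsPath ∧ ∀ w ∈ p.support, w = 0 ∨ (0 < w 1 ∧ w 1 ≤ v 1)

open Classical in
/-- `bₙ`, the number of `n`-step bridges from the origin (`b₀ = 1`). As for `count`, the sum
over endpoints is restricted to the box `{-n,…,n}²`, which contains all of them.
[cite: MadrasSlade1993, Definition 1.2.4] [cite: DuminilCopinKozmaYadin2014, §2, eq. (2.1)] -/
def bridgeCount (n : ℕ) : ℕ :=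
  ∑ v ∈ box 2 n, (((zdGraph 2).finsetWalkLength n (0 : Site 2) v).filter fun p => IsBridge p).card

/-- **Hammersley–Welsh (1962), as quoted in eq. (2.1) of the source**: "The number `bₙ` of
self-avoiding bridges of length `n` … satisfies `e^{-c√n} μⁿ ≤ bₙ ≤ μⁿ` for every `n`"
(Madras–Slade, Cor. 3.1.6: `μ^N e^{-B√N} ≤ b_N ≤ μ^N` for `N` large, any `B > π√(2/3)`, and
(1.2.17) `b_N ≤ μ_Bridge^N ≤ μ^N` for all `N`; the constant `c` absorbs small `n` since
`bₙ ≥ 1`). Here `μ = connectiveConstant` (`= infₙ cₙ^{1/n} = limₙ cₙ^{1/n}`). Named fact.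
[cite: DuminilCopinKozmaYadin2014, §2, eq. (2.1)] [cite: MadrasSlade1993, Corollary 3.1.6] -/
def DKY2014_eq21 : Prop :=
  ∃ c : ℝ, ∀ n : ℕ,
    Real.exp (-(c * Real.sqrt n)) * connectiveConstant ^ n ≤ bridgeCount n ∧
      (bridgeCount n : ℝ) ≤ connectiveConstant ^ n

/-! ### Squared walks (Lemma 5) -/

/-- The diagonal site `(k, k)`. [cite: DuminilCopinKozmaYadin2014, §2 (squared walks)] -/
def diag (k : ℕ) : Site 2 := fun _ => (k : ℤ)

/-- A **squared walk** (of span `k`): "a self-avoiding walk such that `γ₀ = (0,0)`, `γₙ = (k,k)`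
and `γ ⊂ [0,k]²`" for some `k ∈ ℕ` (the span is determined by the endpoint).
[cite: DuminilCopinKozmaYadin2014, §2 (before Lemma 5)] -/
def IsSquaredWalk {v : Site 2} (p : (zdGraph 2).Walk (0 : Site 2) v) : Prop :=
  p.IsPath ∧ ∃ k : ℕ, v = diag k ∧ ∀ w ∈ p.support, ∀ i, 0 ≤ w i ∧ w i ≤ k

open Classical in
/-- `aₙ`, the number of squared walks of length `n` (of any span). As for `count`, the sum over
endpoints is restricted to the box `{-n,…,n}²`, which contains all of them.
[cite: DuminilCopinKozmaYadin2014, Lemma 5] -/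
def squaredWalkCount (n : ℕ) : ℕ :=
  ∑ v ∈ box 2 n,
    (((zdGraph 2).finsetWalkLength n (0 : Site 2) v).filter fun p => IsSquaredWalk p).card

/-- **Lemma 5 of the source** (named fact): "For `c` sufficiently large and `n` even, the number
`aₙ` of squared walks of length `n` satisfies `aₙ ≥ μⁿ e^{-c√n}`." (Proof in print: unfold a
bridge into a walk contained in the rectangle spanned by its endpoints, an `e^{c√n}`-to-one map
by Hardy–Ramanujan, then glue two rectangle walks with a common endpoint `(k,l)` into a squared
walk of span `k + l` by a diagonal reflection.) [cite: DuminilCopinKozmaYadin2014, Lemma 5] -/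
def DKY2014_lem5 : Prop :=
  ∃ c : ℝ, ∀ n : ℕ, Even n →
    connectiveConstant ^ n * Real.exp (-(c * Real.sqrt n)) ≤ squaredWalkCount n

/-! ### Self-avoiding polygons through the four cardinal edges of a square (Proposition 3) -/

/-- A finite set of edges `E` of `G` is a **self-avoiding polygon**: the edge set of a cycle of
`G` (Madras–Slade, Def. 3.2.1: the bonds of an `(N-1)`-step self-avoiding walk with adjacent
endpoints together with the closing bond; the polygon has `N = #E` steps, neither starting
point nor orientation being specified). [cite: MadrasSlade1993, Definition 3.2.1] -/
def IsPolygon {V : Type*} [DecidableEq V] (G : SimpleGraph V) (E : Finset (Sym2 V)) : Prop :=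
  ∃ (u : V) (c : G.Walk u u), c.IsCycle ∧ c.edges.toFinset = E

/-- The lattice square `[0, 2m+1]² ∩ ℤ²` (side length `2m+1`, `(2m+2)²` sites).
[cite: DuminilCopinKozmaYadin2014, §2 (definition of P_m)] -/
def squareBox (m : ℕ) : Finset (Site 2) :=
  Fintype.piFinset fun _ => Finset.Icc (0 : ℤ) (2 * m + 1)

/-- The four **cardinal edges** of the square `[0, 2m+1]²`, "the edges `[(m,0),(m+1,0)]`,
`[(2m+1,m),(2m+1,m+1)]`, `[(m,2m+1),(m+1,2m+1)]` and `[(0,m),(0,m+1)]`" (the lattice edges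
in the middle of its four sides). [cite: DuminilCopinKozmaYadin2014, §2 (definition of P_m)] -/
def cardinalEdges (m : ℕ) : Finset (Sym2 (Site 2)) :=
  {s(![(m : ℤ), 0], ![(m : ℤ) + 1, 0]),
    s(![2 * (m : ℤ) + 1, m], ![2 * (m : ℤ) + 1, (m : ℤ) + 1]),
    s(![(m : ℤ), 2 * (m : ℤ) + 1], ![(m : ℤ) + 1, 2 * (m : ℤ) + 1]),
    s(![0, (m : ℤ)], ![0, (m : ℤ) + 1])}

open Classical in
/-- `P_m`: "the set of self-avoiding polygons in `[0,2m+1]²` that touch the middle of every face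
of the square", i.e. the polygons of `ℤ²` all of whose edges have both endpoints in the square
and which contain the four cardinal edges. [cite: DuminilCopinKozmaYadin2014, §2 (definition of P_m)] -/
def facePolygons (m : ℕ) : Finset (Finset (Sym2 (Site 2))) :=
  (edgesIn (zdGraph 2) (squareBox m)).powerset.filter fun E =>
    IsPolygon (zdGraph 2) E ∧ cardinalEdges m ⊆ E

/-- `Z_m(x) = Σ_{γ ∈ P_m} x^{|γ|}`, "the partition function (with parameter `x`) of `P_m`".
[cite: DuminilCopinKozmaYadin2014, §2 (definition of Z_m)] -/
def Zbox (m : ℕ) (x : ℝ) : ℝ :=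
  ∑ E ∈ facePolygons m, x ^ E.card

/-- **Proposition 3 of the source** (named fact): "For `x > 1/μ`, we have
`limsup_{m → ∞} Z_m(x) = ∞`", i.e. `Z_m(x)` exceeds every bound for infinitely many `m`; here
`1/μ = criticalFugacity`. (Proof in print: four squared walks of length `n` and common span,
rotated and translated into the four quarters of `[0,2m+1]²` and joined by the four cardinal
edges, give `Z_m(x) ≥ (x^{n+1} μⁿ e^{-c√n}/n)⁴ → ∞` by Lemma 5.)
[cite: DuminilCopinKozmaYadin2014, Proposition 3] -/
def DKY2014_prop3 : Prop :=
  ∀ x : ℝ, criticalFugacity < x → ∀ M : ℝ, ∃ᶠ m in atTop, M ≤ Zbox m x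

/-! ### Boxes of side length `2m+1` on the grid `(2m+2)ℤ²` (§3) -/

/-- The box `B(z) := (2m+2)·z + [0, 2m+1]²` of side length `2m+1` with lower-left corner
`(2m+2) z` ("we will assume that all our boxes have their lower left corner in `(2m+2)δℤ²`";
these boxes tile `ℤ²`). [cite: DuminilCopinKozmaYadin2014, §3 (m-boxes)] -/
def mBox (m : ℕ) (z : Site 2) : Finset (Site 2) :=
  (squareBox m).image fun w => (2 * (m : ℤ) + 2) • z + w

/-- `V_F`, "the set of vertices in boxes of `F`", for a family `F` of boxes given by their
corners `z ∈ F`. [cite: DuminilCopinKozmaYadin2014, §3 (V_F)] -/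
def boxVertices (m : ℕ) (F : Finset (Site 2)) : Finset (Site 2) :=
  F.biUnion (mBox m)

/-- A family `F` of grid boxes (given by their corners) is **connected**: "every two boxes can be
connected by a path of adjacent boxes in `F`", where two grid boxes "are said to be adjacent if
they are disjoint and each has a cardinal edge, `[xy]` and `[zt]` respectively, such that
`x ∼ z`, `y ∼ t`" — for boxes on the grid `(2m+2)ℤ²` this is adjacency `z ∼ z'` of their corners
in `ℤ²`, which is the definition taken here (the induced graph on `F` is preconnected).
[cite: DuminilCopinKozmaYadin2014, §3 (adjacent boxes, connected families)] -/
def IsConnectedFamily (F : Finset (Site 2)) : Prop :=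
  ((zdGraph 2).induce (F : Set (Site 2))).Preconnected

/-! ### API -/

/-- Bridges are self-avoiding walks: `bₙ ≤ cₙ`. [cite: MadrasSlade1993, §1.2 (bₙ ≤ cₙ)] -/
theorem bridgeCount_le_count (n : ℕ) : bridgeCount n ≤ count n := by
  classical
  unfold bridgeCount count
  refine Finset.sum_le_sum fun v _ => Finset.card_le_card ?_
  intro p
  simp only [Finset.mem_filter]
  exact fun h => ⟨h.1, h.2.1⟩

/-- Squared walks are self-avoiding walks: `aₙ ≤ cₙ`. [cite: DuminilCopinKozmaYadin2014, §2] -/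
theorem squaredWalkCount_le_count (n : ℕ) : squaredWalkCount n ≤ count n := by
  classical
  unfold squaredWalkCount count
  refine Finset.sum_le_sum fun v _ => Finset.card_le_card ?_
  intro p
  simp only [Finset.mem_filter]
  exact fun h => ⟨h.1, h.2.1⟩

/-- `b₀ = 1` ("By convention, `b₀ = 1`": the trivial walk). [cite: MadrasSlade1993, Definition 1.2.4] -/
theorem bridgeCount_zero : bridgeCount 0 = 1 := by
  classical
  rw [bridgeCount, box_two_zero, Finset.sum_singleton]
  simp only [SimpleGraph.finsetWalkLength, dite_true]
  rw [Finset.filter_singleton, if_pos, Finset.card_singleton]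
  exact ⟨SimpleGraph.Walk.IsPath.nil, fun w hw => Or.inl (by simpa using hw)⟩

/-- `a₀ = 1` (the trivial walk, of span `0`). [cite: DuminilCopinKozmaYadin2014, Lemma 5] -/
theorem squaredWalkCount_zero : squaredWalkCount 0 = 1 := by
  classical
  rw [squaredWalkCount, box_two_zero, Finset.sum_singleton]
  simp only [SimpleGraph.finsetWalkLength, dite_true]
  rw [Finset.filter_singleton, if_pos, Finset.card_singleton]
  refine ⟨SimpleGraph.Walk.IsPath.nil, 0, funext fun i => by simp [diag], fun w hw i => ?_⟩
  simp only [SimpleGraph.Walk.support_nil, List.mem_singleton] at hw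
  subst hw
  simp

/-- A polygon has as many edges as the length of any cycle tracing it.
[cite: MadrasSlade1993, Definition 3.2.1] -/
theorem IsPolygon.exists_length_eq {V : Type*} [DecidableEq V] {G : SimpleGraph V}
    {E : Finset (Sym2 V)} (h : IsPolygon G E) :
    ∃ (u : V) (c : G.Walk u u), c.IsCycle ∧ c.length = E.card := by
  obtain ⟨u, c, hc, rfl⟩ := h
  refine ⟨u, c, hc, ?_⟩
  rw [List.toFinset_card_of_nodup hc.edges_nodup, SimpleGraph.Walk.length_edges]

/-- Membership in `P_m`, unfolded. [cite: DuminilCopinKozmaYadin2014, §2 (definition of P_m)] -/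
theorem mem_facePolygons_iff {m : ℕ} {E : Finset (Sym2 (Site 2))} :
    E ∈ facePolygons m ↔
      E ⊆ edgesIn (zdGraph 2) (squareBox m) ∧ IsPolygon (zdGraph 2) E ∧ cardinalEdges m ⊆ E := by
  classical
  rw [facePolygons, Finset.mem_filter, Finset.mem_powerset]

/-- `Z_m(x) ≥ 0` for `x ≥ 0`. [cite: DuminilCopinKozmaYadin2014, §2 (definition of Z_m)] -/
theorem Zbox_nonneg (m : ℕ) {x : ℝ} (hx : 0 ≤ x) : 0 ≤ Zbox m x :=
  Finset.sum_nonneg fun _ _ => pow_nonneg hx _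

/-- `Z_m(x)` is monotone in `x ≥ 0`. [cite: DuminilCopinKozmaYadin2014, §2 (definition of Z_m)] -/
theorem Zbox_mono (m : ℕ) {x y : ℝ} (hx : 0 ≤ x) (hxy : x ≤ y) : Zbox m x ≤ Zbox m y :=
  Finset.sum_le_sum fun _ _ => pow_le_pow_left₀ hx hxy _


/-- Membership in the square `[0, 2m+1]²`. [cite: DuminilCopinKozmaYadin2014, §2 (definition of P_m)] -/
theorem mem_squareBox_iff {m : ℕ} {v : Site 2} :
    v ∈ squareBox m ↔ ∀ i, 0 ≤ v i ∧ v i ≤ 2 * m + 1 := by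
  simp [squareBox, Fintype.mem_piFinset]

/-- Membership in the box `B(z)`: coordinates in `[(2m+2) zᵢ, (2m+2) zᵢ + 2m + 1]`.
[cite: DuminilCopinKozmaYadin2014, §3 (m-boxes)] -/
theorem mem_mBox_iff {m : ℕ} {z v : Site 2} :
    v ∈ mBox m z ↔ ∀ i, (2 * m + 2) * z i ≤ v i ∧ v i ≤ (2 * m + 2) * z i + (2 * m + 1) := by
  simp only [mBox, Finset.mem_image, mem_squareBox_iff]
  constructor
  · rintro ⟨w, hw, rfl⟩ i
    have := hw i
    simp only [Pi.add_apply, Pi.smul_apply, smul_eq_mul]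
    constructor <;> linarith [this.1, this.2]
  · intro h
    refine ⟨v - (2 * (m : ℤ) + 2) • z, fun i => ?_, by simp⟩
    have := h i
    simp only [Pi.sub_apply, Pi.smul_apply, smul_eq_mul]
    constructor <;> linarith [this.1, this.2]

/-- The box with corner `0` is the square `[0, 2m+1]²`. [cite: DuminilCopinKozmaYadin2014, §3 (m-boxes)] -/
theorem mBox_zero (m : ℕ) : mBox m 0 = squareBox m := by
  simp [mBox]

/-- Membership in `V_F`. [cite: DuminilCopinKozmaYadin2014, §3 (V_F)] -/
theorem mem_boxVertices_iff {m : ℕ} {F : Finset (Site 2)} {v : Site 2} :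
    v ∈ boxVertices m F ↔ ∃ z ∈ F, v ∈ mBox m z := by
  simp [boxVertices]

/-! ### Non-vacuity: the unit square is a polygon of `P_0`, so `Z_0(x) ≥ x⁴` -/

namespace UnitSquare

open SimpleGraph

/-- Corner `(0,0)`. [folklore] -/
def p0 : Site 2 := ![0, 0]
/-- Corner `(1,0)`. [folklore] -/
def p1 : Site 2 := ![1, 0]
/-- Corner `(1,1)`. [folklore] -/
def p2 : Site 2 := ![1, 1]
/-- Corner `(0,1)`. [folklore] -/
def p3 : Site 2 := ![0, 1]

/-- `(0,0) ∼ (1,0)`. [folklore] -/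
theorem h01 : (zdGraph 2).Adj p0 p1 := by rw [zdGraph_adj_iff]; exact ⟨0, Or.inl (by decide)⟩
/-- `(1,0) ∼ (1,1)`. [folklore] -/
theorem h12 : (zdGraph 2).Adj p1 p2 := by rw [zdGraph_adj_iff]; exact ⟨1, Or.inl (by decide)⟩
/-- `(1,1) ∼ (0,1)`. [folklore] -/
theorem h23 : (zdGraph 2).Adj p2 p3 := by rw [zdGraph_adj_iff]; exact ⟨0, Or.inr (by decide)⟩
/-- `(0,1) ∼ (0,0)`. [folklore] -/
theorem h30 : (zdGraph 2).Adj p3 p0 := by rw [zdGraph_adj_iff]; exact ⟨1, Or.inr (by decide)⟩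

/-- The boundary of the unit square as a closed walk of `ℤ²`. [folklore] -/
def cycle : (zdGraph 2).Walk p0 p0 :=
  Walk.cons h01 (Walk.cons h12 (Walk.cons h23 (Walk.cons h30 Walk.nil)))

/-- The boundary of the unit square is a cycle. [folklore] -/
theorem cycle_isCycle : cycle.IsCycle := by
  rw [cycle, Walk.cons_isCycle_iff]
  refine ⟨?_, ?_⟩
  · simp only [Walk.cons_isPath_iff, Walk.isPath_iff_nil, Walk.support_cons, Walk.support_nil,
      List.mem_cons]
    decide
  · simp only [Walk.edges_cons, Walk.edges_nil, List.mem_cons]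
    decide

/-- The unit square (its four edges are the four cardinal edges of `[0,1]²`) belongs to `P_0`.
[cite: DuminilCopinKozmaYadin2014, §2 (definition of P_m)] -/
theorem edges_mem_facePolygons_zero : cycle.edges.toFinset ∈ facePolygons 0 := by
  classical
  rw [mem_facePolygons_iff]
  refine ⟨?_, ⟨p0, cycle, cycle_isCycle, rfl⟩, ?_⟩
  · intro e he
    simp only [cycle, Walk.edges_cons, Walk.edges_nil, List.toFinset_cons, List.toFinset_nil,
      Finset.mem_insert, Finset.notMem_empty, or_false] at he
    simp only [edgesIn, edgesTouching, Finset.mem_filter, Finset.mem_biUnion, mem_incidenceFinset,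
      Finset.mem_sym2_iff, squareBox, Fintype.mem_piFinset, Finset.mem_Icc]
    rcases he with rfl | rfl | rfl | rfl
    · refine ⟨⟨p0, by decide, h01, Sym2.mem_mk_left _ _⟩, fun a ha => ?_⟩
      rcases Sym2.mem_iff.1 ha with rfl | rfl <;> decide
    · refine ⟨⟨p1, by decide, h12, Sym2.mem_mk_left _ _⟩, fun a ha => ?_⟩
      rcases Sym2.mem_iff.1 ha with rfl | rfl <;> decide
    · refine ⟨⟨p2, by decide, h23, Sym2.mem_mk_left _ _⟩, fun a ha => ?_⟩
      rcases Sym2.mem_iff.1 ha with rfl | rfl <;> decide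
    · refine ⟨⟨p3, by decide, h30, Sym2.mem_mk_left _ _⟩, fun a ha => ?_⟩
      rcases Sym2.mem_iff.1 ha with rfl | rfl <;> decide
  · intro e he
    simp only [cardinalEdges, Nat.cast_zero, mul_zero, zero_add, Finset.mem_insert,
      Finset.mem_singleton] at he
    simp only [cycle, Walk.edges_cons, Walk.edges_nil, List.toFinset_cons, List.toFinset_nil,
      Finset.mem_insert, Finset.notMem_empty, or_false]
    rcases he with rfl | rfl | rfl | rfl <;> decide

/-- The unit square has four edges. [folklore] -/
theorem card_edges : cycle.edges.toFinset.card = 4 := by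
  rw [List.toFinset_card_of_nodup cycle_isCycle.edges_nodup, Walk.length_edges]
  rfl

end UnitSquare

/-- `Z_0(x) ≥ x⁴` for `x ≥ 0` (the unit square; in fact `Z_0(x) = x⁴`). [cite: DuminilCopinKozmaYadin2014, §2 (definition of Z_m)] -/
theorem pow_four_le_Zbox_zero {x : ℝ} (hx : 0 ≤ x) : x ^ 4 ≤ Zbox 0 x := by
  rw [Zbox, ← UnitSquare.card_edges]
  exact Finset.single_le_sum (f := fun E => x ^ E.card) (fun _ _ => pow_nonneg hx _)
    UnitSquare.edges_mem_facePolygons_zero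

end Literature.Probability.RandomPlanarGeometry.SAW
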